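import Mathlib.Algebra.CubicDiscriminant
import Mathlib.FieldTheory.IsAlgClosed.Basic
import Mathlib.LinearAlgebra.Eigenspace.Charpoly
import Mathlib.LinearAlgebra.Charpoly.ToMatrix
import Mathlib.LinearAlgebra.Matrix.Charpoly.Coeff
import Mathlib.LinearAlgebra.Matrix.NonsingularInverse
import Mathlib.LinearAlgebra.Matrix.ToLinearEquiv
import Literature.Computability.AlgebraicComplexity.MatrixMultiplicationExponent
import HarnessLib

/-!
# Generic `3 × 3 × 3` tensors are a rank-`3` tensor plus a rank-`2` matrix times a vector (Alman–Li 2026, proof of Prop. 4.3)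

Topic `Literature/Computability/AlgebraicComplexity`. The EXPLICIT (generic) half of the proof of
J. Alman, B. Li, *Asymptotic Rank Speedup Theorems, Revisited* (arXiv:2605.21738), Proposition 4.3
(p. 10 of the held text `paper:arxiv-2605.21738`): "If `T` is generic, we may first assume that the
`z₁`-slice of `T` is a nonsingular matrix. By a change of basis, we assume that the `z₁`-slice is of
the form `x₁y₁ + x₂y₂ + x₃y₃`. Furthermore, we can assume the `z₂`-slice is a diagonalizable matrix …
`α₁x₁y₁ + α₂x₂y₂ + α₃x₃y₃`. Now we can write the tensor `T` as `∑ᵢ xᵢyᵢ(z₁ + αᵢz₂) + (xMy)z₃` …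
Letting `λ` be one of the eigenvalues of `M`, then `T = ∑ᵢ xᵢyᵢ(z₁ + αᵢz₂ + λz₃) + x(M − λI)y z₃`
where the first summation can be restricted from `⟨3⟩` and the second term is a matrix of rank at
most `2`, which is a restriction of `⟨1,2,1⟩`."

In the coordinates of `MatrixMultiplicationExponent.lean` (`T : Fin 3 → Fin 3 → Fin 3 → K`, third
index = the `z`-slices `S_k = (T x y k)_{x,y}`, `triad w u v = w ⊗ u ⊗ v`) the conclusion is the
**five-triad form**
`T = ∑_{i<3} aᵢ ⊗ bᵢ ⊗ cᵢ + u₀ ⊗ v₀ ⊗ w + u₁ ⊗ v₁ ⊗ w` (the last two triads SHARE the third vector),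
and "generic" is made explicit as: `det S₀ ≠ 0` and `S₀⁻¹S₁` (equivalently `adj(S₀)·S₁`) has three
distinct eigenvalues. Everything here is proved; there are no definitions and no named facts.

* `exists_eigenvector_of_isRoot_charpoly` — a root of the characteristic polynomial of a square matrix
  over a field has an eigenvector (Mathlib's `Module.End.hasEigenvalue_iff_isRoot_charpoly`, in
  matrix form).
* `exists_three_eigenvalues_of_discr_ne_zero` — over an algebraically closed field, a `3 × 3` matrix
  whose characteristic cubic has non-zero discriminant (Mathlib's `Cubic.discr`) has three distinct
  eigenvalues.
* `exists_isUnit_det_apply_zero_eq` — a non-zero vector of `K³` is the first column of an invertible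
  matrix.
* `exists_fiveTriads_of_eigen` — the five-triad form above, from `det S₀ ≠ 0`, three distinct
  eigenvalues of `adj(S₀)·S₁`, over an algebraically closed field (the eigenvalue `λ` of the third
  slice is where algebraic closure is used a second time).

The degeneration `T ⊴ ⟨3⟩ ⊕ ⟨1,2,1⟩` for ALL `T` (the other half of Prop. 4.3, via Zariski closure of
the restriction locus) is NOT here; `AlmanLi2026ThreeByThreeProofs.lean` replaces it by the Zariski
closedness of the sublevel sets of `R̃` (CHNVZ 2025).

## References

* J. Alman, B. Li, *Asymptotic Rank Speedup Theorems, Revisited*, arXiv:2605.21738 (2026), proof of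
  Proposition 4.3. [AlmanLi2026]
-/

noncomputable section

open scoped BigOperators
open Matrix Polynomial

namespace Literature.Computability.AlgebraicComplexity

universe u

section Eigen

variable {K : Type u} [Field K]

/-- **A root of the characteristic polynomial is an eigenvalue, with an eigenvector** (matrix form of
Mathlib's `Module.End.hasEigenvalue_iff_isRoot_charpoly` through `Matrix.toLin'`). [folklore] -/
theorem exists_eigenvector_of_isRoot_charpoly {n : Type} [Fintype n] [DecidableEq n]
    (A : Matrix n n K) {μ : K} (h : A.charpoly.IsRoot μ) :
    ∃ v : n → K, v ≠ 0 ∧ A *ᵥ v = μ • v := by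
  have h1 : Module.End.HasEigenvalue (Matrix.toLin' A) μ := by
    rw [Module.End.hasEigenvalue_iff_isRoot_charpoly, Matrix.charpoly_toLin']
    exact h
  obtain ⟨v, hv⟩ := h1.exists_hasEigenvector
  refine ⟨v, hv.right, ?_⟩
  have h2 := hv.apply_eq_smul
  rwa [Matrix.toLin'_apply] at h2

/-- The characteristic polynomial of a `3 × 3` matrix is the cubic with coefficients
`(1, c₂, c₁, c₀)`, `c_k` its coefficients (it is monic of degree `3`). [folklore] -/
theorem toPoly_cubic_charpoly (A : Matrix (Fin 3) (Fin 3) K) :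
    (⟨1, A.charpoly.coeff 2, A.charpoly.coeff 1, A.charpoly.coeff 0⟩ : Cubic K).toPoly = A.charpoly := by
  have hm := Matrix.charpoly_monic A
  have hdeg : A.charpoly.natDegree = 3 := by
    rw [Matrix.charpoly_natDegree_eq_dim]; simp
  conv_rhs => rw [hm.as_sum, hdeg]
  simp only [Cubic.toPoly, Finset.sum_range_succ, Finset.sum_range_zero, zero_add, pow_zero, mul_one,
    pow_one, map_one, one_mul]
  ring

/-- **Three distinct eigenvalues from a non-zero discriminant**: over an algebraically closed field,
if the characteristic cubic `X³ + c₂X² + c₁X + c₀` of a `3 × 3` matrix `A` has `Cubic.discr ≠ 0`,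
then `A` has three pairwise distinct eigenvalues (the cubic splits, and the discriminant is
`∏_{i<j} (βᵢ - βⱼ)²`, Mathlib `Cubic.discr_ne_zero_iff_roots_ne`). [folklore] -/
theorem exists_three_eigenvalues_of_discr_ne_zero [IsAlgClosed K] (A : Matrix (Fin 3) (Fin 3) K)
    (h : Cubic.discr (⟨1, A.charpoly.coeff 2, A.charpoly.coeff 1, A.charpoly.coeff 0⟩ : Cubic K) ≠ 0) :
    ∃ β : Fin 3 → K, Function.Injective β ∧ ∀ i, A.charpoly.IsRoot (β i) := by
  set P : Cubic K := ⟨1, A.charpoly.coeff 2, A.charpoly.coeff 1, A.charpoly.coeff 0⟩ with hP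
  have ha : P.a ≠ 0 := one_ne_zero
  have htoPoly : P.toPoly = A.charpoly := toPoly_cubic_charpoly A
  have hsplit : (P.toPoly.map (RingHom.id K)).Splits := by
    rw [Polynomial.map_id]; exact IsAlgClosed.splits _
  obtain ⟨x, y, z, h3⟩ := (Cubic.splits_iff_roots_eq_three ha).1 hsplit
  have hne := (Cubic.discr_ne_zero_iff_roots_ne ha h3).1 h
  have hmapP : Cubic.map (RingHom.id K) P = P := rfl
  have hroots : ∀ r ∈ ({x, y, z} : Multiset K), A.charpoly.IsRoot r := by
    intro r hr
    rw [← h3, hmapP] at hr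
    have hr' : r ∈ A.charpoly.roots := by simpa [Cubic.roots, htoPoly] using hr
    exact (Polynomial.mem_roots (Matrix.charpoly_monic A).ne_zero).1 hr'
  obtain ⟨hxy, hxz, hyz⟩ := hne
  refine ⟨![x, y, z], ?_, ?_⟩
  · intro i j hij
    fin_cases i <;> fin_cases j <;> simp at hij ⊢ <;>
      first
      | exact absurd hij hxy | exact absurd hij.symm hxy | exact absurd hij hxz
      | exact absurd hij.symm hxz | exact absurd hij hyz | exact absurd hij.symm hyz
  · intro i
    fin_cases i <;> exact hroots _ (by simp)

/-- **A non-zero vector is the first column of an invertible matrix** (complete `t` by two standard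
basis vectors `e_{k+1}, e_{k+2}`, `t_k ≠ 0`; the determinant is then `t_k`). [folklore] -/
theorem exists_isUnit_det_apply_zero_eq (t : Fin 3 → K) (ht : t ≠ 0) :
    ∃ G : Matrix (Fin 3) (Fin 3) K, IsUnit G.det ∧ ∀ x, G x 0 = t x := by
  obtain ⟨k, hk⟩ := Function.ne_iff.1 ht
  refine ⟨Matrix.of fun x c =>
      ![t x, if x = k + 1 then (1 : K) else 0, if x = k + 2 then (1 : K) else 0] c, ?_, fun x => rfl⟩
  have hdet : (Matrix.of fun x c =>
      ![t x, if x = k + 1 then (1 : K) else 0, if x = k + 2 then (1 : K) else 0] c).det = t k := by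
    fin_cases k <;> simp [Matrix.det_fin_three]
  rw [hdet]
  exact isUnit_iff_ne_zero.2 hk

end Eigen

/-! ## The five-triad form of a generic tensor -/

section FiveTriads

variable {K : Type u} [Field K]

/-- **Alman–Li 2026, proof of Prop. 4.3 (generic case), in coordinates.** Let
`T : Fin 3 → Fin 3 → Fin 3 → K` over an algebraically closed field, with `z`-slices
`S_k = (T x y k)_{x,y}`. If `det S₀ ≠ 0` and `adj(S₀)·S₁` has three pairwise distinct eigenvalues
(equivalently: `S₀⁻¹S₁` is diagonalisable with distinct eigenvalues — "the `z₂`-slice is a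
diagonalizable matrix" after the change of basis making the `z₁`-slice the identity), then
`T = ∑_{i<3} aᵢ ⊗ bᵢ ⊗ cᵢ + ∑_{j<2} uⱼ ⊗ vⱼ ⊗ w`: a rank-`≤ 3` tensor plus a rank-`≤ 2` matrix
tensored with ONE vector `w` (= `e₂`) in the third mode. Construction as printed: with `P` the matrix
of eigenvectors, `aᵢ = S₀ P eᵢ`, `bᵢ = row i of P⁻¹`, `cᵢ = (1, αᵢ, λ)` (`αᵢ` the pencil eigenvalues,
`λ` an eigenvalue of `S₀⁻¹S₂`), and `S₂ − λS₀ = u₀ ⊗ v₀ + u₁ ⊗ v₁` of rank `≤ 2`.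
[cite: AlmanLi2026, Proposition 4.3 (proof)] -/
theorem exists_fiveTriads_of_eigen [IsAlgClosed K] (T : Fin 3 → Fin 3 → Fin 3 → K)
    (hdet : (Matrix.of fun x y => T x y 0).det ≠ 0)
    (hβ : ∃ β : Fin 3 → K, Function.Injective β ∧
      ∀ i, ((Matrix.of fun x y => T x y 0).adjugate * Matrix.of fun x y => T x y 1).charpoly.IsRoot
        (β i)) :
    ∃ (a b c : Fin 3 → Fin 3 → K) (u v : Fin 2 → Fin 3 → K) (w : Fin 3 → K),
      T = (∑ i, triad (a i) (b i) (c i)) + ∑ j, triad (u j) (v j) w := by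
  classical
  obtain ⟨β, hβinj, hβroot⟩ := hβ
  set S₁ : Matrix (Fin 3) (Fin 3) K := Matrix.of fun x y => T x y 0 with hS₁
  set S₂ : Matrix (Fin 3) (Fin 3) K := Matrix.of fun x y => T x y 1 with hS₂
  set S₃ : Matrix (Fin 3) (Fin 3) K := Matrix.of fun x y => T x y 2 with hS₃
  set A : Matrix (Fin 3) (Fin 3) K := S₁.adjugate * S₂ with hA
  -- eigenvectors of `A = adj(S₁) S₂`
  have heig : ∀ i, ∃ s : Fin 3 → K, s ≠ 0 ∧ A *ᵥ s = β i • s := fun i =>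
    exists_eigenvector_of_isRoot_charpoly A (hβroot i)
  choose s hs0 hs using heig
  -- the matrix `P` with columns `s i` is invertible (eigenvectors for distinct eigenvalues)
  set P : Matrix (Fin 3) (Fin 3) K := Matrix.of fun x i => s i x with hP
  have hli : LinearIndependent K s :=
    Module.End.eigenvectors_linearIndependent' (Matrix.toLin' A) β hβinj s fun i =>
      ⟨Module.End.mem_eigenspace_iff.2 (by rw [Matrix.toLin'_apply, hs i]), hs0 i⟩
  have hPunit : IsUnit P.det := by
    have h1 : LinearIndependent K P.col := hli
    exact (Matrix.isUnit_iff_isUnit_det _).1 (Matrix.linearIndependent_cols_iff_isUnit.1 h1)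
  -- the pencil relation `det S₁ • S₂ sᵢ = βᵢ • S₁ sᵢ`
  have hS₁A : S₁ * A = S₁.det • S₂ := by
    rw [hA, ← Matrix.mul_assoc, Matrix.mul_adjugate, Matrix.smul_mul, Matrix.one_mul]
  have hpencil : ∀ i, S₂ *ᵥ s i = (β i / S₁.det) • (S₁ *ᵥ s i) := by
    intro i
    have h1 : S₁.det • (S₂ *ᵥ s i) = β i • (S₁ *ᵥ s i) := by
      calc S₁.det • (S₂ *ᵥ s i) = (S₁.det • S₂) *ᵥ s i := by rw [Matrix.smul_mulVec]
        _ = (S₁ * A) *ᵥ s i := by rw [hS₁A]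
        _ = S₁ *ᵥ (A *ᵥ s i) := by rw [Matrix.mulVec_mulVec]
        _ = β i • (S₁ *ᵥ s i) := by rw [hs i, Matrix.mulVec_smul]
    have h2 := congrArg (fun v => S₁.det⁻¹ • v) h1
    simp only [smul_smul, inv_mul_cancel₀ hdet, one_smul] at h2
    rw [h2, div_eq_inv_mul]
  -- `λ`: an eigenvalue of the pencil `(S₁, S₃)`, with a kernel vector `t` of `S₃ - λ S₁`
  set B : Matrix (Fin 3) (Fin 3) K := S₁.adjugate * S₃ with hB
  obtain ⟨μ, hμ⟩ : ∃ μ, B.charpoly.IsRoot μ :=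
    IsAlgClosed.exists_root _ (by rw [Matrix.charpoly_degree_eq_dim]; simp)
  obtain ⟨t, ht0, ht⟩ := exists_eigenvector_of_isRoot_charpoly B hμ
  set lam : K := μ / S₁.det with hlam
  set N : Matrix (Fin 3) (Fin 3) K := S₃ - lam • S₁ with hN
  have hNt : N *ᵥ t = 0 := by
    have hS₁B : S₁ * B = S₁.det • S₃ := by
      rw [hB, ← Matrix.mul_assoc, Matrix.mul_adjugate, Matrix.smul_mul, Matrix.one_mul]
    have h1 : S₁.det • (S₃ *ᵥ t) = μ • (S₁ *ᵥ t) := by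
      calc S₁.det • (S₃ *ᵥ t) = (S₁.det • S₃) *ᵥ t := by rw [Matrix.smul_mulVec]
        _ = (S₁ * B) *ᵥ t := by rw [hS₁B]
        _ = S₁ *ᵥ (B *ᵥ t) := by rw [Matrix.mulVec_mulVec]
        _ = μ • (S₁ *ᵥ t) := by rw [ht, Matrix.mulVec_smul]
    have h2 := congrArg (fun v => S₁.det⁻¹ • v) h1
    simp only [smul_smul, inv_mul_cancel₀ hdet, one_smul] at h2
    rw [hN, Matrix.sub_mulVec, Matrix.smul_mulVec, h2, hlam, div_eq_inv_mul, sub_self]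
  -- complete `t` to an invertible matrix `G` (first column `t`)
  obtain ⟨G, hGunit, hGt⟩ := exists_isUnit_det_apply_zero_eq t ht0
  -- expansions `M = (M P) P⁻¹`
  have hSP : ∀ (M : Matrix (Fin 3) (Fin 3) K) x i, (M * P) x i = (M *ᵥ s i) x := by
    intro M x i
    simp [Matrix.mul_apply, Matrix.mulVec, dotProduct, hP]
  have key₁ : ∀ x y, S₁ x y = ∑ i, (S₁ * P) x i * P⁻¹ i y := fun x y => by
    rw [← Matrix.mul_apply, Matrix.mul_nonsing_inv_cancel_right _ _ hPunit]
  have key₂ : ∀ x y, S₂ x y = ∑ i, (S₁ * P) x i * P⁻¹ i y * (β i / S₁.det) := fun x y => by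
    have h1 : S₂ x y = ∑ i, (S₂ * P) x i * P⁻¹ i y := by
      rw [← Matrix.mul_apply, Matrix.mul_nonsing_inv_cancel_right _ _ hPunit]
    rw [h1]
    refine Finset.sum_congr rfl fun i _ => ?_
    rw [hSP, hSP, hpencil i, Pi.smul_apply, smul_eq_mul]
    ring
  have key₃ : ∀ x y, N x y = ∑ j : Fin 2, (N * G) x j.succ * G⁻¹ j.succ y := fun x y => by
    have h1 : N x y = ∑ k, (N * G) x k * G⁻¹ k y := by
      rw [← Matrix.mul_apply, Matrix.mul_nonsing_inv_cancel_right _ _ hGunit]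
    have h0 : (N * G) x 0 = 0 := by
      have h2 : (N * G) x 0 = (N *ᵥ t) x := by
        simp [Matrix.mul_apply, Matrix.mulVec, dotProduct, hGt]
      rw [h2, hNt, Pi.zero_apply]
    rw [h1, Fin.sum_univ_succ, h0, zero_mul, zero_add]
  refine ⟨fun i x => (S₁ * P) x i, fun i y => P⁻¹ i y, fun i => ![1, β i / S₁.det, lam],
    fun j x => (N * G) x j.succ, fun j y => G⁻¹ j.succ y, ![0, 0, 1], ?_⟩
  funext x y z
  simp only [Pi.add_apply, Finset.sum_apply, triad_apply]
  refine Fin.cases ?_ (fun z => Fin.cases ?_ (fun z => Fin.cases ?_ (fun z => z.elim0) z) z) z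
  · -- the slice `S₁`
    show T x y 0 = _
    have h := key₁ x y
    rw [show S₁ x y = T x y 0 from rfl] at h
    simpa using h
  · -- the slice `S₂`
    show T x y 1 = _
    have h := key₂ x y
    rw [show S₂ x y = T x y 1 from rfl] at h
    simpa using h
  · -- the slice `S₃ = λ S₁ + N`
    show T x y 2 = _
    have h3 : T x y 2 = lam * S₁ x y + N x y := by
      rw [show T x y 2 = S₃ x y from rfl, hN, Matrix.sub_apply, Matrix.smul_apply, smul_eq_mul]
      ring
    rw [h3, key₃ x y, key₁ x y, Finset.mul_sum]
    simp only [Fin.isValue, Matrix.cons_val_succ, Matrix.cons_val_zero, mul_one]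
    exact congrArg₂ (· + ·) (Finset.sum_congr rfl fun i _ => by ring) rfl

end FiveTriads

end Literature.Computability.AlgebraicComplexity

end
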